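import Summits.ResolutionOfSingularities.ResolutionOfSingularities.Theorems.FrobeniusClosingPatchingRelPerfectConeMemberChartIdeals
import Summits.ResolutionOfSingularities.ResolutionOfSingularities.Theorems.FrobeniusClosingPatchingRelPerfectCoreRungTowerCharts
import Literature.AlgebraicGeometry.Resolution.BlowupChartQuotients
import Literature.AlgebraicGeometry.Resolution.AffineBlowupAlgebra
import HarnessLib

/-!
# Crux `PatchingRelPerfect` (stmt-ResolutionOfSingularities-16161), chain w52 — CORE RUNG r2pt,
# part 2a: the LAST step of the cone tower, abstractly — blowing up the plane `W₀ = V(w, u')`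
# and then the strict transform `V(u', G)` of the cone

[OURS · L1 W5.2 · rung] The third and fourth blow-ups of the cone tower (part 2b instantiates):
`A` is a regular ring (a chart of `Bl_{z₀} Bl_𝔪 Spec S`) with a quasi-regular pair `c = (w, u')`
(`w` the newest exceptional parameter, `u'` the strict transform of the first one) whose
quotient `A/(w, u')` is regular, and `G ∈ A` (the strict transform of the cone equation) with
`G` a non-zero-divisor modulo `(w, u')`, `A/(w, u', G)` regular, and `A/(u', G)` regular at
every prime NOT containing `w` (this is where the cone's regularity off its vertex enters).
The ideal to principalise is `J = (u', w G)` (zero set `V(w, u') ∪ V(u', G)`).  PROVED: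

* `map_chartBase_J_one` — on the `u'`-chart of `Bl_{(w,u')} Spec A` the ideal `J` becomes the
  exceptional Cartier divisor `(y)`; `map_chartBase_J_zero` — on the `w`-chart it becomes
  `w' · (u₂, G̃)`, `u₂ = u'/w`, `G̃` the image of `G`;
* `isRegularRing_quot_span_u₂_G` — **`D₀ ⧸ (u₂, G̃)` is a regular ring** (the strict transform
  of the cone after two point/plane blow-ups): at primes containing `w'` by the regular sequence
  `(w', u₂, G̃)` (toolkit `isRegularLocalRing_localization_quotient_of_isWeaklyRegular_cons`), at
  primes not containing `w'` by transport through `D₀[1/w'] = A[1/w]` from `A/(u', G)` (toolkit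
  `isRegularLocalRing_localization_quotient_of_notMem_of_away`);
* `isRegular_of_isBlowup_map_J` — hence every blow-up of either chart along the transform of
  `J` is regular (Liu 8.1.19 (a), Stacks 080B).

Arbitrary regular rings; nothing here is a statement of the manuscript under review.

## References

* Q. Liu, *Algebraic Geometry and Arithmetic Curves*, OUP 2002, Thm. 8.1.19 (a). [Liu2002]
* The Stacks Project, Tags 080B, 0804, 07Z3, 0BIQ. [StacksProject]
* H. Matsumura, *Commutative Ring Theory*, CUP 1986, Thms. 14.2, 16.3. [Matsumura1987]
-/

-- `Summit.<Summit>.<Sub>.Theorems` with `Sub = Summit` (single-conjunct summit, D-0017)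
set_option linter.dupNamespace false

noncomputable section

open CategoryTheory CategoryTheory.Limits AlgebraicGeometry Literature.AlgebraicGeometry.Resolution
open IsLocalRing

namespace Summit.ResolutionOfSingularities.ResolutionOfSingularities.Theorems

namespace ConeRung

universe u

/-! ## Generalities -/

/-- The image of a chart generator under the chart map `B_i → R[1/c_i]`: `e_j ↦ c_j / c_i`.
[cite: StacksProject, Tag 0804] -/
theorem reesChart_chartGen {R : Type u} [CommRing R] {n : ℕ} (c : Fin n → R) (i j : Fin n) :
    reesChart (c i) (Ideal.mem_span_range_self (f := c) (x := i)) (chartGen c i j) =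
      algebraMap R (Localization.Away (c i)) (c j) * IsLocalization.Away.invSelf (c i) := by
  rw [chartGen, reesChart_mk (c i) _ (reesT_mem_one_smul c j) (coe_reesT _ _), pow_one]

/-- A generator ideal containing the chart element maps to the exceptional ideal: if
`𝔞 ≤ (c)` and `c_i ∈ 𝔞` then `𝔞 B_i = (c_i/1)`. [cite: StacksProject, Tag 0804] -/
theorem map_chartBase_eq_span_of_mem_of_le {R : Type u} [CommRing R] {n : ℕ} (c : Fin n → R)
    (i : Fin n) {𝔞 : Ideal R} (hle : 𝔞 ≤ Ideal.span (Set.range c)) (hmem : c i ∈ 𝔞) :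
    𝔞.map (chartBase c i) = Ideal.span {chartBase c i (c i)} := by
  apply le_antisymm
  · calc 𝔞.map (chartBase c i) ≤ (Ideal.span (Set.range c)).map (chartBase c i) :=
          Ideal.map_mono hle
      _ = Ideal.span {chartBase c i (c i)} := map_reesChartBase_eq (c i) _
  · rw [Ideal.span_singleton_le_iff_mem]
    exact Ideal.mem_map_of_mem _ hmem

/-- A quotient module `R ⧸ I` is `r`-torsion-free when the class of `r` is a non-zero-divisor of
the ring `R ⧸ I`. [folklore] -/
theorem isSMulRegular_quotient_of_mem_nonZeroDivisors {R : Type u} [CommRing R] (I : Ideal R)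
    (r : R) (hr : Ideal.Quotient.mk I r ∈ nonZeroDivisors (R ⧸ I)) :
    IsSMulRegular (R ⧸ I) r := by
  intro a b hab
  obtain ⟨a, rfl⟩ := Ideal.Quotient.mk_surjective a
  obtain ⟨b, rfl⟩ := Ideal.Quotient.mk_surjective b
  have h : Ideal.Quotient.mk I r * (Ideal.Quotient.mk I a - Ideal.Quotient.mk I b) = 0 := by
    rw [mul_sub, ← map_mul, ← map_mul, sub_eq_zero]
    have hab' : Ideal.Quotient.mk I (r • a) = Ideal.Quotient.mk I (r • b) := by
      rw [← Ideal.Quotient.mk_eq_mk, ← Ideal.Quotient.mk_eq_mk, Submodule.Quotient.mk_smul,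
        Submodule.Quotient.mk_smul]
      exact hab
    simpa only [smul_eq_mul] using hab'
  rw [mul_comm] at h
  exact sub_eq_zero.mp ((mem_nonZeroDivisors_iff_right.mp hr) _ h)


/-- Constants that are non-zero-divisors stay non-zero-divisors in a polynomial ring. [folklore] -/
theorem MvPolynomial.C_mem_nonZeroDivisors {σ : Type*} {R : Type*} [CommRing R] {r : R}
    (hr : r ∈ nonZeroDivisors R) :
    (MvPolynomial.C r : MvPolynomial σ R) ∈ nonZeroDivisors (MvPolynomial σ R) := by
  refine mem_nonZeroDivisors_iff_right.mpr fun p hp => ?_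
  ext m
  rw [mul_comm] at hp
  have h := congrArg (MvPolynomial.coeff m) hp
  rw [MvPolynomial.coeff_C_mul, MvPolynomial.coeff_zero, mul_comm] at h
  rw [MvPolynomial.coeff_zero]
  exact (mem_nonZeroDivisors_iff_right.mp hr) _ h

/-- A ring isomorphism preserves non-zero-divisors. [folklore] -/
theorem RingEquiv.map_mem_nonZeroDivisors {R S : Type*} [CommRing R] [CommRing S] (e : R ≃+* S)
    {r : R} (hr : r ∈ nonZeroDivisors R) : e r ∈ nonZeroDivisors S :=
  mem_nonZeroDivisors_of_injective (f := e.symm) e.symm.injective (by rwa [e.symm_apply_apply])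

/-! ## The last step of the cone tower -/

section LastStep

variable {A : Type u} [CommRing A] (w u' G : A)

local notation3 "c₃" => (Fin.cons w (fun _ : Fin 1 => u') : Fin 2 → A)
local notation3 "JJ" => Ideal.span {u', w * G}
/-- the `w`-chart `D₀` and its data -/
local notation3 "D₀" => chartRing c₃ 0
local notation3 "ψ₀" => chartBase c₃ 0
local notation3 "w'" => chartBase c₃ 0 (c₃ 0)
local notation3 "u₂" => chartGen c₃ 0 1
local notation3 "Gt" => chartBase c₃ 0 G

/-- `(c) = (w, u')`. [folklore] -/
theorem span_range_cthree : Ideal.span (Set.range c₃) = Ideal.span {w, u'} := by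
  rw [Fin.range_cons, Set.range_const]

/-- `J = (u', w G) ⊆ (w, u')`. [folklore] -/
theorem J_le_span_range : JJ ≤ Ideal.span (Set.range c₃) := by
  rw [span_range_cthree, Ideal.span_le]
  rintro _ (rfl | rfl)
  · exact Ideal.subset_span (Or.inr rfl)
  · exact Ideal.mul_mem_right _ _ (Ideal.subset_span (Or.inl rfl))

/-- **On the `u'`-chart the ideal `J` becomes the exceptional Cartier divisor `(y)`.**
[cite: StacksProject, Tag 0804] -/
theorem map_chartBase_J_one : (JJ).map (chartBase c₃ 1) = Ideal.span {chartBase c₃ 1 (c₃ 1)} :=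
  map_chartBase_eq_span_of_mem_of_le c₃ 1 (J_le_span_range w u' G) (Ideal.subset_span (Or.inl rfl))

/-- **On the `w`-chart `J` becomes `w' · (u₂, G̃)`**, `u₂ = u'/w`, `G̃ = ψ₀(G)`. [folklore] -/
theorem map_chartBase_J_zero : (JJ).map ψ₀ = Ideal.span {w'} * Ideal.span {u₂, Gt} := by
  have h0 : ψ₀ w = w' := rfl
  have h1 : ψ₀ u' = w' * u₂ := reesChartBase_apply_eq_mul_chartGen c₃ 0 1
  rw [Ideal.map_span, Set.image_insert_eq, Set.image_singleton, map_mul, h0, h1,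
    span_singleton_mul_span_pair]

/-- The stage ideals on the `w`-chart: `(w') + K D₀ + (u₂)`. [folklore] -/
theorem chartStageIdeal_cthree (K : Ideal A) :
    chartStageIdeal c₃ 0 K {1} = Ideal.span {w'} ⊔ Ideal.span {u₂} ⊔ K.map ψ₀ := by
  rw [chartStageIdeal, Set.image_singleton, sup_right_comm]

/-- `0 ∉ {1}` in `Fin 2`. [folklore] -/
theorem zero_notMem_one : (0 : Fin 2) ∉ ({1} : Set (Fin 2)) := by
  rw [Set.mem_singleton_iff]; exact zero_ne_one

/-- The variable type of the stage quotients on the `w`-chart is empty. [folklore] -/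
theorem isEmpty_stageVars : IsEmpty {m : Fin 2 // m ≠ 0 ∧ m ∉ ({1} : Set (Fin 2))} := by
  refine ⟨fun ⟨m, h0, h1⟩ => ?_⟩
  rw [Set.mem_singleton_iff] at h1
  fin_cases m
  · exact h0 rfl
  · exact h1 rfl

variable [IsRegularRing A] (hc : IsQuasiRegular (Fin.cons w (fun _ : Fin 1 => u') : Fin 2 → A))
  [hq : IsRegularRing (A ⧸ Ideal.span (Set.range (Fin.cons w (fun _ : Fin 1 => u') : Fin 2 → A)))]

include hc in
/-- The two charts of `Bl_{(w, u')} Spec A` are regular rings (Liu 8.1.19 (a) on the charts).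
[cite: Liu2002, Thm. 8.1.19 (a) (affine charts)] -/
theorem isRegularRing_chartThree (l : Fin 2) : IsRegularRing (chartRing c₃ l) :=
  isRegularRing_blowupChart c₃ l hc

omit [IsRegularRing A] hq in
include hc in
/-- `(w', u₂)` is a weakly regular sequence on `D₀`. [cite: StacksProject, Tag 0BIQ] -/
theorem isWeaklyRegular_w'_u₂ : RingTheory.Sequence.IsWeaklyRegular D₀ [w', u₂] := by
  have h := CoreRungTower.isWeaklyRegular_chartFamily c₃ 0
    (fun _ : Fin 1 => (⟨1, one_ne_zero⟩ : {l : Fin 2 // l ≠ 0})) hc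
    (Function.injective_of_subsingleton _)
  simpa [List.ofFn_succ] using h

omit [IsRegularRing A] hq in
include hc in
/-- **`(w', u₂, G̃)` is a weakly regular sequence on `D₀`** when `G` is a non-zero-divisor modulo
`(w, u')`: `D₀/(w', u₂) ≅ A/(w, u')` (`chartStageEquiv`, no variables left) carries `G̃` to `Ḡ`.
[cite: StacksProject, Tag 0BIQ] -/
theorem isWeaklyRegular_w'_u₂_G
    (hG : Ideal.Quotient.mk (Ideal.span (Set.range c₃)) G ∈
      nonZeroDivisors (A ⧸ Ideal.span (Set.range c₃))) :
    RingTheory.Sequence.IsWeaklyRegular D₀ [w', u₂, Gt] := by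
  classical
  have h12 := isWeaklyRegular_w'_u₂ w u' hc
  rw [show [w', u₂, Gt] = [w', u₂] ++ [Gt] from rfl, RingTheory.Sequence.isWeaklyRegular_append_iff]
  refine ⟨h12, ?_⟩
  rw [RingTheory.Sequence.isWeaklyRegular_singleton_iff]
  -- the stage quotient `D₀ ⧸ (w', u₂) ≅ (A ⧸ ((w,u') + 0))[∅]`
  set I₂ : Ideal D₀ := Ideal.ofList [w', u₂] with hI₂
  have hstage : chartStageIdeal c₃ 0 ⊥ {1} = I₂ := by
    rw [chartStageIdeal_cthree, Ideal.map_bot, sup_bot_eq, hI₂, Ideal.ofList_cons,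
      Ideal.ofList_singleton]
  let ε := chartStageEquiv c₃ 0 ⊥ {1} hc (zero_notMem_one)
  -- `Ḡ` is a non-zero-divisor of the coefficient ring `A ⧸ ((w,u') ⊔ ⊥)`
  have hG' : Ideal.Quotient.mk (Ideal.span (Set.range c₃) ⊔ ⊥) G ∈
      nonZeroDivisors (A ⧸ (Ideal.span (Set.range c₃) ⊔ ⊥)) := by
    have := RingEquiv.map_mem_nonZeroDivisors
      (Ideal.quotEquivOfEq (R := A) (sup_bot_eq (a := Ideal.span (Set.range c₃))).symm) hG
    rwa [Ideal.quotEquivOfEq_mk] at this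
  have hC := MvPolynomial.C_mem_nonZeroDivisors
    (σ := {m : Fin 2 // m ≠ 0 ∧ m ∉ ({1} : Set (Fin 2))}) hG'
  have hεC := RingEquiv.map_mem_nonZeroDivisors ε hC
  rw [chartStageEquiv_C] at hεC
  -- transport to `D₀ ⧸ I₂`
  have hI : Ideal.Quotient.mk I₂ Gt ∈ nonZeroDivisors (D₀ ⧸ I₂) := by
    have := RingEquiv.map_mem_nonZeroDivisors (Ideal.quotEquivOfEq hstage) hεC
    rwa [Ideal.quotEquivOfEq_mk] at this
  have hsm := isSMulRegular_quotient_of_mem_nonZeroDivisors I₂ Gt hI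
  have hK : (Ideal.ofList [w', u₂] • ⊤ : Submodule D₀ D₀) = I₂ := by
    rw [smul_eq_mul, Ideal.mul_top]
  exact ((Submodule.quotEquivOfEq _ _ hK).isSMulRegular_congr _).mpr hsm

omit [IsRegularRing A] hq in
include hc in
/-- **`D₀ ⧸ (w', u₂, G̃)` is a regular ring** when `A ⧸ (w, u', G)` is: the stage quotient is
`A ⧸ ((w, u') + (G))` with no variables left. [cite: StacksProject, Tag 0BIQ] -/
theorem isRegularRing_quot_w'_u₂_G
    [hqG : IsRegularRing (A ⧸ (Ideal.span (Set.range c₃) ⊔ Ideal.span {G}))] :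
    IsRegularRing (D₀ ⧸ Ideal.ofList [w', u₂, Gt]) := by
  classical
  have hstage : chartStageIdeal c₃ 0 (Ideal.span {G}) {1} = Ideal.ofList [w', u₂, Gt] := by
    rw [chartStageIdeal_cthree, Ideal.map_span, Set.image_singleton, Ideal.ofList_cons,
      Ideal.ofList_cons, Ideal.ofList_singleton, sup_assoc]
  let ε := chartStageEquiv c₃ 0 (Ideal.span {G}) {1} hc (zero_notMem_one)
  haveI : IsRegularRing (MvPolynomial {m : Fin 2 // m ≠ 0 ∧ m ∉ ({1} : Set (Fin 2))}
      (A ⧸ (Ideal.span (Set.range c₃) ⊔ Ideal.span {G}))) :=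
    MvPolynomial.isRegularRing_of_isRegularRing _
  exact IsRegularRing.of_ringEquiv (ε.trans (Ideal.quotEquivOfEq hstage))

include hc in
/-- **`D₀ ⧸ (u₂, G̃)` — the strict transform of the cone after the two blow-ups — is a regular
ring.**  At primes containing `w'`: the regular sequence `(w', u₂, G̃)` with regular quotient
(toolkit `isRegularLocalRing_localization_quotient_of_isWeaklyRegular_cons`).  At primes not
containing `w'`: `D₀[1/w'] = A[1/w]` carries `(u₂, G̃)` to `(u', G)`, and `A ⧸ (u', G)` is regular
off `V(w)` by hypothesis (toolkit `isRegularLocalRing_localization_quotient_of_notMem_of_away`).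
[cite: Matsumura1987, Thm. 16.3] [cite: StacksProject, Tag 07Z3] -/
theorem isRegularRing_quot_span_u₂_G
    (hG : Ideal.Quotient.mk (Ideal.span (Set.range c₃)) G ∈
      nonZeroDivisors (A ⧸ Ideal.span (Set.range c₃)))
    [hqG : IsRegularRing (A ⧸ (Ideal.span (Set.range c₃) ⊔ Ideal.span {G}))]
    (hoff : ∀ (P : Ideal (A ⧸ Ideal.span {u', G})) [P.IsPrime],
      Ideal.Quotient.mk (Ideal.span {u', G}) w ∉ P → IsRegularLocalRing (Localization.AtPrime P)) :
    IsRegularRing (D₀ ⧸ Ideal.span {u₂, Gt}) := by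
  haveI hD : IsRegularRing D₀ := isRegularRing_chartThree w u' hc 0
  haveI : IsNoetherianRing (D₀ ⧸ Ideal.span {u₂, Gt}) := Ideal.Quotient.isNoetherianRing _
  have hofList : Ideal.ofList [u₂, Gt] = Ideal.span {u₂, Gt} := by
    rw [Ideal.ofList_cons, Ideal.ofList_singleton, ← Ideal.span_insert]
  rw [isRegularRing_iff]
  intro Qbar hQbar
  by_cases hw : Ideal.Quotient.mk (Ideal.span {u₂, Gt}) w' ∈ Qbar
  · -- on the exceptional divisor: the regular sequence `(w', u₂, G̃)`
    haveI := isRegularRing_quot_w'_u₂_G w u' G hc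
    let e := Ideal.quotEquivOfEq (R := D₀) hofList
    set Qbar' : Ideal (D₀ ⧸ Ideal.ofList [u₂, Gt]) := Qbar.comap e with hQbar'
    have hw' : Ideal.Quotient.mk (Ideal.ofList [u₂, Gt]) w' ∈ Qbar' := by
      rw [hQbar', Ideal.mem_comap]
      change e (Ideal.Quotient.mk _ w') ∈ Qbar
      rwa [Ideal.quotEquivOfEq_mk]
    haveI := isRegularLocalRing_localization_quotient_of_isWeaklyRegular_cons w' [u₂, Gt]
      (isWeaklyRegular_w'_u₂_G w u' G hc hG) Qbar' hw'
    exact isRegularLocalRing_localization_of_ringEquiv e Qbar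
  · -- off the exceptional divisor: transport from `A ⧸ (u', G)` through `D₀[1/w'] = A[1/w]`
    letI alg : Algebra D₀ (Localization.Away (c₃ 0)) :=
      (reesChart (c₃ 0) (Ideal.mem_span_range_self (f := c₃) (x := 0))).toAlgebra
    haveI hloc : IsLocalization.Away w' (Localization.Away (c₃ 0)) :=
      isLocalization_reesChart (c₃ 0) (Ideal.mem_span_range_self (f := c₃) (x := 0))
    have hunit : IsUnit (IsLocalization.Away.invSelf (S := Localization.Away (c₃ 0)) (c₃ 0)) :=
      IsUnit.of_mul_eq_one (algebraMap A (Localization.Away (c₃ 0)) (c₃ 0))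
        (by rw [mul_comm]; exact IsLocalization.Away.mul_invSelf (c₃ 0))
    have hJ : (Ideal.span {u₂, Gt}).map
        (algebraMap D₀ (Localization.Away (c₃ 0)) : D₀ →+* Localization.Away (c₃ 0)) =
        (Ideal.span {u', G}).map
          (algebraMap A (Localization.Away (c₃ 0)) : A →+* Localization.Away (c₃ 0)) := by
      rw [Ideal.map_span, Set.image_insert_eq, Set.image_singleton, Ideal.map_span,
        Set.image_insert_eq, Set.image_singleton, RingHom.algebraMap_toAlgebra, reesChart_chartGen,
        reesChart_reesChartBase, Ideal.span_insert, Ideal.span_singleton_mul_right_unit hunit,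
        ← Ideal.span_insert]
      rfl
    exact isRegularLocalRing_localization_quotient_of_notMem_of_away (c₃ 0) w'
      (Ideal.span {u', G}) (Ideal.span {u₂, Gt}) hJ (fun P _ hP => hoff P hP) Qbar hw

include hc in
/-- **The `w`-chart: every blow-up of `Spec D₀` along `J D₀ = w' (u₂, G̃)` is regular** (twist
off `w'`, then Liu 8.1.19 (a) with the regular centre `V(u₂, G̃)`).
[cite: Liu2002, Thm. 8.1.19 (a)] [cite: StacksProject, Tag 080B (proof)] -/
theorem isRegular_of_isBlowup_map_J_zero
    (hG : Ideal.Quotient.mk (Ideal.span (Set.range c₃)) G ∈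
      nonZeroDivisors (A ⧸ Ideal.span (Set.range c₃)))
    [hqG : IsRegularRing (A ⧸ (Ideal.span (Set.range c₃) ⊔ Ideal.span {G}))]
    (hoff : ∀ (P : Ideal (A ⧸ Ideal.span {u', G})) [P.IsPrime],
      Ideal.Quotient.mk (Ideal.span {u', G}) w ∉ P → IsRegularLocalRing (Localization.AtPrime P))
    {Y : Scheme.{u}} {ρ : Y ⟶ Spec (.of D₀)}
    (hρ : IsBlowup ρ (affineBlowup.idealSheaf ((JJ).map ψ₀))) : Scheme.IsRegular Y := by
  haveI := isRegularRing_chartThree w u' hc 0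
  haveI := isRegularRing_quot_span_u₂_G w u' G hc hG hoff
  rw [map_chartBase_J_zero] at hρ
  exact isRegular_of_isBlowup_span_singleton_mul_of_forall
    (reesChartBase_mem_nonZeroDivisors (c₃ 0) (Ideal.mem_span_range_self (f := c₃) (x := 0))) _
    (fun Y' ρ' h' => isRegular_of_isBlowup_idealSheaf_of_quotient _ h') hρ

include hc in
/-- **The `u'`-chart: every blow-up of `Spec D₁` along `J D₁ = (y)` is regular** (an isomorphism
onto the regular chart). [cite: Liu2002, Thm. 8.1.19 (a) (affine charts)] -/
theorem isRegular_of_isBlowup_map_J_one {Y : Scheme.{u}} {ρ : Y ⟶ Spec (.of (chartRing c₃ 1))}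
    (hρ : IsBlowup ρ (affineBlowup.idealSheaf ((JJ).map (chartBase c₃ 1)))) :
    Scheme.IsRegular Y := by
  haveI := isRegularRing_chartThree w u' hc 1
  rw [map_chartBase_J_one] at hρ
  exact isRegular_of_isBlowup_idealSheaf_span_singleton_of_isRegularRing
    (reesChartBase_mem_nonZeroDivisors (c₃ 1) (Ideal.mem_span_range_self (f := c₃) (x := 1))) hρ

include hc in
/-- **Every blow-up of either chart of `Bl_{(w,u')} Spec A` along the transform of
`J = (u', w G)` is regular.** [cite: Liu2002, Thm. 8.1.19 (a)] -/
theorem isRegular_of_isBlowup_map_J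
    (hG : Ideal.Quotient.mk (Ideal.span (Set.range c₃)) G ∈
      nonZeroDivisors (A ⧸ Ideal.span (Set.range c₃)))
    [hqG : IsRegularRing (A ⧸ (Ideal.span (Set.range c₃) ⊔ Ideal.span {G}))]
    (hoff : ∀ (P : Ideal (A ⧸ Ideal.span {u', G})) [P.IsPrime],
      Ideal.Quotient.mk (Ideal.span {u', G}) w ∉ P → IsRegularLocalRing (Localization.AtPrime P))
    (l : Fin 2) {Y : Scheme.{u}} {ρ : Y ⟶ Spec (.of (chartRing c₃ l))}
    (hρ : IsBlowup ρ (affineBlowup.idealSheaf ((JJ).map (chartBase c₃ l)))) :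
    Scheme.IsRegular Y := by
  fin_cases l
  · exact isRegular_of_isBlowup_map_J_zero w u' G hc hG hoff hρ
  · exact isRegular_of_isBlowup_map_J_one w u' G hc hρ

end LastStep

end ConeRung

end Summit.ResolutionOfSingularities.ResolutionOfSingularities.Theorems

end
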